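import Summits.QuantumFields.QCD.Theorems.SpectralDefectExtinctionWindowExtinctionStubFluxTemplateHalfCoercive
import HarnessLib

/-!
# The centre-flux template class `Tm` (stub `stub_fluxTemplateHalf`, assembly)

Stub `stub_fluxTemplateHalf` (S5b-m) of line `free-volume-heavy-witness` (reshape r3) of crux
`Summit.QuantumFields.QCD.Theses.SpectralDefectExtinction.WindowExtinction` (item stmt-QuantumFields-8964),
assembled from its three landed parts:

* `…StubFluxTemplateHalfCycle.lean` — the magnetic four-cycle bound and the link perturbation;
* `…StubFluxTemplateHalfCoercive.lean` — `stub_fluxTemplateHalf_coercive`: near the centre-flux box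
  template the Wilson form is coercive on box-supported spinors,
  `(m + 4 − 2√3 − 12η)‖ψ‖² ≤ Re⟨ψ, D_W(U,m,1)ψ⟩`;
* `…StubFluxTemplateHalfSpectral.lean` — `stub_fluxTemplateHalf_spectral`: coercivity of the Wilson
  form on box-supported spinors makes the box principal block of `Γ₅ D_W` invertible with exactly
  `6(2R+1)⁴` negative eigenvalues (chiral min–max).

Here: the tube `Tm = ∏_{(y,μ)} {g ∈ SU(3) | ∀ a b, |g_{ab} − ω_μ(y) δ_{ab}| ≤ 1/100}` around the
centre-flux box configuration (`ω_0 = ω_2 = 1`, `ω_1(y) = ω^{y₀+R}`, `ω_3(y) = ω^{y₂+R}`,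
`ω = -1/2 + i√3/2 ∈ Z(SU(3))`; every `(0,1)`- and `(2,3)`-plaquette of the box has holonomy `ω·1`) is
measurable (product of closed sets, `fluxHalf_isClosed_tube`), Haar-positive (`Measure.pi_pi` and
`fluxHalf_haar_tube_ne_zero`: each closed tube contains an open tube around the element
`ω_μ(y) • 1 ∈ SU(3)`, charged by the Haar measure, an `IsOpenPosMeasure`), and at `|δ| ≤ 1/4` the
coercivity constant `4 − δ − 2√3 − 12/100` is positive (`fluxHalf_kappa_pos`).
-/

noncomputable section

namespace Summit.QuantumFields.QCD.Cruxes.WindowExtinction.FreeVolumeHeavyWitness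

open Matrix MeasureTheory
open Literature.MathematicalPhysics Literature.MathematicalPhysics.QuantumLattice
  Literature.MathematicalPhysics.QuantumFieldTheory Literature.Probability.LatticeModels
open Summit.QuantumFields.QCD.Theorems.ExtinctionBuildsQCD.Negative
open scoped BigOperators Classical ComplexConjugate

/-! ## Assembly: the centre-flux tube `Tm` -/

/-- `ω³ = 1` for `ω = -1/2 + i√3/2`. -/
theorem fluxHalf_omega_pow_three (s : ℝ) (hs : s * s = 3) : (⟨-1 / 2, s / 2⟩ : ℂ) ^ 3 = 1 := by
  have h2 : (⟨-1 / 2, s / 2⟩ : ℂ) ^ 2 = ⟨-1 / 2, -(s / 2)⟩ := by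
    apply Complex.ext
    · simp only [pow_two, Complex.mul_re]
      nlinarith
    · simp only [pow_two, Complex.mul_im]
      ring
  rw [pow_succ, h2]
  apply Complex.ext
  · simp only [Complex.mul_re, Complex.one_re]
    nlinarith
  · simp only [Complex.mul_im, Complex.one_im]
    ring

/-- The tube factors are closed. -/
theorem fluxHalf_isClosed_tube (T : Matrix (Fin 3) (Fin 3) ℂ) (η : ℝ) :
    IsClosed {g : SU3 | ∀ a b, ‖(g : Matrix (Fin 3) (Fin 3) ℂ) a b - T a b‖ ≤ η} := by
  simp only [Set.setOf_forall]
  exact isClosed_iInter fun a => isClosed_iInter fun b =>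
    isClosed_le ((continuous_subtype_val.matrix_elem a b).sub continuous_const).norm continuous_const

/-- The open tube factors are open. -/
theorem fluxHalf_isOpen_tube (T : Matrix (Fin 3) (Fin 3) ℂ) (η : ℝ) :
    IsOpen {g : SU3 | ∀ a b, ‖(g : Matrix (Fin 3) (Fin 3) ℂ) a b - T a b‖ < η} := by
  simp only [Set.setOf_forall]
  exact isOpen_iInter_of_finite fun a => isOpen_iInter_of_finite fun b =>
    isOpen_lt ((continuous_subtype_val.matrix_elem a b).sub continuous_const).norm continuous_const

/-- A closed tube of positive radius around a scalar centre-type element `u • 1 ∈ SU(3)` has positive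
Haar probability. -/
theorem fluxHalf_haar_tube_ne_zero (u : ℂ) (hu : Complex.normSq u = 1) (hu3 : u ^ 3 = 1) {η : ℝ}
    (hη : 0 < η) :
    haarProbability SU3 {g : SU3 | ∀ a b,
      ‖(g : Matrix (Fin 3) (Fin 3) ℂ) a b - u * (1 : Matrix (Fin 3) (Fin 3) ℂ) a b‖ ≤ η} ≠ 0 := by
  haveI : (haarProbability SU3).IsOpenPosMeasure := by
    unfold haarProbability; infer_instance
  set g₀ : SU3 := ⟨u • (1 : Matrix (Fin 3) (Fin 3) ℂ), fluxHalf_smul_one_mem_specialUnitaryGroup u hu hu3⟩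
    with hg₀
  have hO := fluxHalf_isOpen_tube (fun a b => u * (1 : Matrix (Fin 3) (Fin 3) ℂ) a b) η
  have hmem : g₀ ∈ {g : SU3 | ∀ a b,
      ‖(g : Matrix (Fin 3) (Fin 3) ℂ) a b - u * (1 : Matrix (Fin 3) (Fin 3) ℂ) a b‖ < η} := by
    intro a b
    simp only [hg₀, Matrix.smul_apply, smul_eq_mul, sub_self, norm_zero]
    exact hη
  refine ((hO.measure_pos (haarProbability SU3) ⟨g₀, hmem⟩).trans_le (measure_mono ?_)).ne'
  intro g hg a b
  exact (hg a b).le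

/-- `2√3 < 4 - 1/4 - 12/100`: the coercivity constant at `|δ| ≤ 1/4`, `η = 1/100` is positive. -/
theorem fluxHalf_kappa_pos (s : ℝ) (hs : s * s = 3) (hs0 : 0 < s) {δ : ℝ} (hδ : |δ| ≤ 1 / 4) :
    0 < -δ + 4 - 2 * s - 12 * (1 / 100) := by
  have h1 := (abs_le.1 hδ).2
  nlinarith

/-- **STUB S5b-m `stub_fluxTemplateHalf`** (= `FluxTemplateHalf` of the r3 skeleton of line
`free-volume-heavy-witness`).  For every radius `R` the tube
`Tm = {t | ∀ (y,μ) a b, |t(y,μ)_{ab} − ω_μ(y) δ_{ab}| ≤ 1/100}` around the centre-flux box configuration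
(`ω_0 = ω_2 = 1`, `ω_1(y) = ω^{y₀+R}`, `ω_3(y) = ω^{y₂+R}`, `ω = e^{2πi/3}`) is measurable (a product of
closed sets), Haar-positive (a product of closed tubes around elements of `SU(3)`, each containing a
non-empty open tube), and for every field whose box content lies in `Tm` and every `|δ| ≤ 1/4` the Wilson
form at mass `−δ` is coercive on box-supported spinors with constant `4 − 2√3 − δ − 12/100 > 0`
(`stub_fluxTemplateHalf_coercive`), whence the box block of `Γ₅ D_W(U, −δ, 1)` is invertible with exactly
`6(2R+1)⁴` negative eigenvalues (`stub_fluxTemplateHalf_spectral`). -/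
theorem stub_fluxTemplateHalf :
    ∀ R : ℕ, ∃ Tm : Set ((↥(box 4 R) × Fin 4) → SU3), MeasurableSet Tm ∧
      (Measure.pi fun _ : ↥(box 4 R) × Fin 4 => haarProbability SU3) Tm ≠ 0 ∧
      ∀ δ : ℝ, |δ| ≤ 1 / 4 → ∀ (n : ℕ) [NeZero n], 2 * R + 1 < n →
        ∀ (c : Fin 4 → ℤ) (U : GaugeConfig 4 n SU3),
          (fun yi : ↥(box 4 R) × Fin 4 => U (Torus.proj n (c + (yi.1 : Fin 4 → ℤ)), yi.2)) ∈ Tm →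
          ((spinorLift gammaFive * wilsonDirac (fundamentalRep (Fin 3)) U (-δ) 1).submatrix
              (Subtype.val : {p : TorusSite 4 n × Fin 3 × Fin 4 //
                ∃ y : ↥(box 4 R), Torus.proj n (c + (y : Fin 4 → ℤ)) = p.1} → _) Subtype.val).det ≠ 0 ∧
          negRootCount ((spinorLift gammaFive * wilsonDirac (fundamentalRep (Fin 3)) U (-δ) 1).submatrix
              (Subtype.val : {p : TorusSite 4 n × Fin 3 × Fin 4 //
                ∃ y : ↥(box 4 R), Torus.proj n (c + (y : Fin 4 → ℤ)) = p.1} → _) Subtype.val) =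
            6 * (2 * R + 1) ^ 4 := by
  intro R
  set s : ℝ := Real.sqrt 3 with hs_def
  have hs : s * s = 3 := Real.mul_self_sqrt (by norm_num)
  have hs0 : 0 < s := Real.sqrt_pos.2 (by norm_num)
  set ω : ℂ := ⟨-1 / 2, s / 2⟩ with hω
  have hnormSq : Complex.normSq ω = 1 := fluxHalf_normSq_omega s hs
  have hω3 : ω ^ 3 = 1 := fluxHalf_omega_pow_three s hs
  have hpow : ∀ k : ℤ, Complex.normSq (ω ^ k) = 1 ∧ (ω ^ k) ^ 3 = 1 := fun k =>
    ⟨by rw [map_zpow₀, hnormSq, _root_.one_zpow],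
     by rw [← zpow_natCast, ← _root_.zpow_mul, mul_comm, _root_.zpow_mul, zpow_natCast, hω3, _root_.one_zpow]⟩
  -- template phases and the tube
  set t : ↥(box 4 R) × Fin 4 → ℂ := fun i =>
    if i.2 = 1 then ω ^ ((i.1 : Fin 4 → ℤ) 0 + R : ℤ)
      else if i.2 = 3 then ω ^ ((i.1 : Fin 4 → ℤ) 2 + R : ℤ) else 1 with ht
  have hti : ∀ i, Complex.normSq (t i) = 1 ∧ t i ^ 3 = 1 := by
    intro i
    have : t i = 1 ∨ ∃ k : ℤ, t i = ω ^ k := by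
      simp only [ht]
      split_ifs
      exacts [Or.inr ⟨_, rfl⟩, Or.inr ⟨_, rfl⟩, Or.inl rfl]
    rcases this with h | ⟨k, hk⟩
    · rw [h]; simp
    · rw [hk]; exact hpow k
  have ht0 : ∀ y : ↥(box 4 R), t (y, 0) = 1 := fun y => by simp [ht]
  have ht1 : ∀ y : ↥(box 4 R), t (y, 1) = ω ^ ((y : Fin 4 → ℤ) 0 + R : ℤ) := fun y => by simp [ht]
  have ht2 : ∀ y : ↥(box 4 R), t (y, 2) = 1 := fun y => by simp [ht]
  have ht3 : ∀ y : ↥(box 4 R), t (y, 3) = ω ^ ((y : Fin 4 → ℤ) 2 + R : ℤ) := fun y => by simp [ht]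
  set B : ↥(box 4 R) × Fin 4 → Set SU3 := fun i =>
    {g : SU3 | ∀ a b, ‖(g : Matrix (Fin 3) (Fin 3) ℂ) a b - t i * (1 : Matrix (Fin 3) (Fin 3) ℂ) a b‖ ≤
      1 / 100} with hB
  refine ⟨Set.univ.pi B, ?_, ?_, ?_⟩
  · -- measurability: a countable product of closed sets
    exact MeasurableSet.univ_pi fun i =>
      (fluxHalf_isClosed_tube (fun a b => t i * (1 : Matrix (Fin 3) (Fin 3) ℂ) a b) (1 / 100)).measurableSet
  · -- Haar positivity: a finite product of Haar-positive tubes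
    rw [Measure.pi_pi]
    exact Finset.prod_ne_zero_iff.2 fun i _ =>
      fluxHalf_haar_tube_ne_zero (t i) (hti i).1 (hti i).2 (by norm_num)
  · -- the box block: coercivity + chiral min–max
    intro δ hδ n _ hn c U hU
    rw [Set.mem_univ_pi] at hU
    have hUB : ∀ (y : Fin 4 → ℤ) (hy : y ∈ box 4 R) (μ : Fin 4) (a b : Fin 3),
        ‖(U (Torus.proj n (c + y), μ) : Matrix (Fin 3) (Fin 3) ℂ) a b -
          t (⟨y, hy⟩, μ) * (1 : Matrix (Fin 3) (Fin 3) ℂ) a b‖ ≤ 1 / 100 :=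
      fun y hy μ a b => hU (⟨y, hy⟩, μ) a b
    have h0 : ∀ y ∈ box 4 R, ∀ a b, ‖(U (Torus.proj n (c + y), 0) : Matrix (Fin 3) (Fin 3) ℂ) a b -
        (1 : Matrix (Fin 3) (Fin 3) ℂ) a b‖ ≤ 1 / 100 := fun y hy a b => by
      have := hUB y hy 0 a b
      rwa [ht0, one_mul] at this
    have h1 : ∀ y ∈ box 4 R, ∀ a b, ‖(U (Torus.proj n (c + y), 1) : Matrix (Fin 3) (Fin 3) ℂ) a b -
        ω ^ (y 0 + R : ℤ) * (1 : Matrix (Fin 3) (Fin 3) ℂ) a b‖ ≤ 1 / 100 := fun y hy a b => by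
      have := hUB y hy 1 a b
      rwa [ht1] at this
    have h2 : ∀ y ∈ box 4 R, ∀ a b, ‖(U (Torus.proj n (c + y), 2) : Matrix (Fin 3) (Fin 3) ℂ) a b -
        (1 : Matrix (Fin 3) (Fin 3) ℂ) a b‖ ≤ 1 / 100 := fun y hy a b => by
      have := hUB y hy 2 a b
      rwa [ht2, one_mul] at this
    have h3 : ∀ y ∈ box 4 R, ∀ a b, ‖(U (Torus.proj n (c + y), 3) : Matrix (Fin 3) (Fin 3) ℂ) a b -
        ω ^ (y 2 + R : ℤ) * (1 : Matrix (Fin 3) (Fin 3) ℂ) a b‖ ≤ 1 / 100 := fun y hy a b => by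
      have := hUB y hy 3 a b
      rwa [ht3] at this
    have hκ := fluxHalf_kappa_pos s hs hs0 hδ
    refine stub_fluxTemplateHalf_spectral n R c hn U (-δ) _ hκ fun ψ hψ => ?_
    have key := stub_fluxTemplateHalf_coercive R s (1 / 100) hs hs0 (by norm_num) n hn c U h0 h1 h2 h3
      (-δ) ψ hψ
    linarith

end Summit.QuantumFields.QCD.Cruxes.WindowExtinction.FreeVolumeHeavyWitness

end
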